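import Summits.CriticalPhenomena.PercolationContinuityZ3.Theorems.PercNearOneGluingNoHeavyLowerTailSahiCoSunflowerOrClosure
import Summits.CriticalPhenomena.PercolationContinuityZ3.Theorems.PercNearOneGluingNoHeavyLowerTailSahiCombMasterFamily
import Mathlib.Tactic.Linarith
import Mathlib.Tactic.Ring
import HarnessLib

/-!
# `NoHeavyLowerTail` (crux stmt-CriticalPhenomena-4575), master-family line P1: the DEEP-CORE HARRIS INEQUALITY

Support file (seat `prim-masterthm-p1`, gen 10; `--supports stmt-CriticalPhenomena-4575`).  One definition (`deepCore`), no `sorry`,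
standard axioms.  Memo `run/shared/lean/prim/prim-masterthm/FROM-prim-masterthm-p1-g10-DEEP-CORE.md`.

THE THEOREM.  For increasing events `U, V` of a finite cube `{0,1}^ι` and every product (Bernoulli) weight `μ_p`, write
`D(U,V) := {ω ∈ U ∩ V | every ω' ⊆ ω lies in U iff it lies in V}` — the DEEP CORE: the points of `U ∩ V` below which `U` and `V`
coincide, i.e. `(U ∩ V) ∖ ↑(U △ V)`.  Then (`deepCore_harris`)

  `μ(U ∩ V) − μ(U)·μ(V) ≥ μ(D(U,V)) · (1 − μ(U ∩ V))`.

PROVENANCE — CORRECTION (gen 10, second instalment; the first instalment's header called this "a new correlation inequality",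
which is WRONG): the inequality is EXACTLY the case `k = 3` of Gladkov's strong Harris–Kleitman inequality `μ(A)μ(B) ≥ e₂(μ(C_i))`
[cite: Gladkov2024StrongFKG, Thm. 2.1] (tree: `Literature.Probability.LatticeModels.prodBernoulli_strongHarris`) for the partition
`A = (U∩V) ∖ D`, cells `(U∖V, V∖U, D)`, `B = (U∪V)ᶜ` — see the sibling file `…SahiDeepCoreGladkov` (`gladkov_deepCore`, derived from the tree's theorem, and
`gladkov_three_cells_of_deepCore_harris`, the converse rewriting).  The deep core is the largest admissible third cell for the pair
`(U, V)`, so the "two-event form" below is the optimal `k = 3` instance, and the induction of §3 is a second proof of that instance in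
the section framework (Gladkov's own argument is the same one-coordinate quadratic step).  Nothing in this file is a new inequality.
It sharpens plain Harris (`D = ∅` is Harris; `U = V` is equality, as is `U = {x₁}, V = {x₁ ∨ x₂}`).  Equivalent forms:
`Cov(U ∩ V, ↑(U △ V)) ≥ μ(U ∖ V)·μ(V ∖ U)` and `μ(U∩V)·μ((U∪V)ᶜ) ≥ μ(U∖V)μ(V∖U) + μ(D)(1 − μ(U∩V))`.
PROOF (induction on a determining coordinate set, step = one coordinate `e` with sections `X⁰ ⊆ X¹`): the law of total covariance
`Cov(U,V) = (1−t)Cov(U⁰,V⁰) + t·Cov(U¹,V¹) + t(1−t)·δ_U δ_V` (`δ_X = μX¹ − μX⁰`), the EXACT section `D(U,V)⁰ = D(U⁰,V⁰)`, the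
inclusions `D(U,V)¹ ⊆ D(U¹,V¹)` and `D(U,V)¹ ∖ D(U,V)⁰ ⊆ (U¹∖U⁰) ∩ (V¹∖V⁰) =: J`, and the pointwise identity behind
`μ(U¹∩V¹) − μ(U⁰∩V⁰) + μ(J) ≤ δ_U + δ_V` reduce the step to `δ_U δ_V ≥ (μ(U¹∩V¹) − μ(U⁰∩V⁰))·(μD¹ − μD⁰)`, which follows from
`μ(J) ≤ min(δ_U, δ_V)` via `(δ_U − j)(δ_V − j) ≥ 0`.

WHY IT IS HERE.  The co-sunflower class law (Sahi's `C_3` on `(G₂∪G₃, G₁∪G₃, G₁∪G₂)` = Kahn's Conjecture 5 on sunflower complements,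
OPEN) is EQUIVALENT to the two-event inequality `(2 − μ(U∪V))·[Cov(U,V) − μ(D)(1 − μ(U∩V))] ≥ μ(D)·μ(U∖V)·μ(V∖U)` (sibling file
`…SahiDeepCoreClassLaw`): the present theorem is exactly its "linear part", and gives `E_3 ≥ −μ(D)μ(U∖V)μ(V∖U)` on the whole class.
HONEST FRAMING: a repackaging (deep-core form) of Gladkov's `k = 3` inequality with an independent proof, plus the reduction lemmas
used by the sibling file; gen 6 already recorded "AT_3 = Gladkov + cubic term"; the class law and Kahn's Conjecture 5 remain OPEN. [this work]
-/

noncomputable section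

open scoped Classical

namespace Summit.CriticalPhenomena.PercolationContinuityZ3.Theorems

namespace SahiDeepCore

open Finset Function
open Literature.Combinatorics.Sahi2008
open Literature.Probability.LatticeModels (prodBernoulli)
open Literature.Probability.Percolation (DeterminedBy determinedBy_iff)
open Literature.Probability.Percolation.DecisionTree (ind ind_of_mem ind_of_not_mem ind_nonneg)

variable {ι : Type} [Fintype ι]

local notation3 (prettyPrint := false) "m⟦" p ", " X "⟧" => ex (bernoulliWeight p) (ind X)

/-! ### 1. The deep core and its sections -/

/-- **The deep core** of two events: the configurations of `U ∩ V` none of whose sub-configurations separates `U` from `V`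
(equivalently `(U ∩ V) ∖ ↑(U △ V)`). [this work] -/
def deepCore (U V : Set (Set ι)) : Set (Set ι) :=
  {ω | ω ∈ U ∩ V ∧ ∀ ω' ⊆ ω, (ω' ∈ U ↔ ω' ∈ V)}

omit [Fintype ι] in
/-- The deep core lies in the intersection. [this work] -/
theorem deepCore_subset_inter (U V : Set (Set ι)) : deepCore U V ⊆ U ∩ V := fun _ h => h.1

omit [Fintype ι] in
/-- The deep core is symmetric. [this work] -/
theorem deepCore_comm (U V : Set (Set ι)) : deepCore U V = deepCore V U := by
  ext ω
  simp only [deepCore, Set.mem_setOf_eq, Set.mem_inter_iff]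
  exact ⟨fun h => ⟨⟨h.1.2, h.1.1⟩, fun ω' hω' => (h.2 ω' hω').symm⟩,
    fun h => ⟨⟨h.1.2, h.1.1⟩, fun ω' hω' => (h.2 ω' hω').symm⟩⟩

omit [Fintype ι] in
/-- The deep core of an event with itself is the event. [this work] -/
theorem deepCore_self (U : Set (Set ι)) : deepCore U U = U := by
  ext ω
  simp only [deepCore, Set.mem_setOf_eq, Set.mem_inter_iff, and_self, iff_self, implies_true, and_true]

omit [Fintype ι] in
/-- A configuration of `U ∩ V` lying outside an INCREASING event that contains `U ∖ V` and `V ∖ U` is in the deep core. [this work] -/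
theorem inter_diff_subset_deepCore {U V N : Set (Set ι)} (hN : IsUpperSet N) (hUV : U \ V ⊆ N) (hVU : V \ U ⊆ N) :
    (U ∩ V) \ N ⊆ deepCore U V := by
  rintro ω ⟨hω, hωN⟩
  refine ⟨hω, fun ω' hω' => ⟨fun hU => ?_, fun hV => ?_⟩⟩
  · by_contra hV
    exact hωN (hN hω' (hUV ⟨hU, hV⟩))
  · by_contra hU
    exact hωN (hN hω' (hVU ⟨hV, hU⟩))

omit [Fintype ι] in
/-- **The `0`-section of the deep core is the deep core of the `0`-sections** (exact). [this work] -/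
theorem secAt_false_deepCore (e : ι) (U V : Set (Set ι)) :
    secAt e false (deepCore U V) = deepCore (secAt e false U) (secAt e false V) := by
  ext ω
  simp only [deepCore, Set.mem_setOf_eq, mem_secAt, forceAt, cond_false, Set.mem_inter_iff]
  refine and_congr Iff.rfl ⟨fun h ω' hω' => h _ (Set.sdiff_subset_sdiff_left hω'), fun h ω' hω' => ?_⟩
  have he : e ∉ ω' := fun he => (hω' he).2 rfl
  have h' := h ω' (hω'.trans Set.sdiff_subset)
  rwa [Set.sdiff_singleton_eq_self he] at h'

omit [Fintype ι] in
/-- The `1`-section of the deep core lies in the deep core of the `1`-sections. [this work] -/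
theorem secAt_true_deepCore_subset (e : ι) (U V : Set (Set ι)) :
    secAt e true (deepCore U V) ⊆ deepCore (secAt e true U) (secAt e true V) := by
  intro ω hω
  simp only [deepCore, Set.mem_setOf_eq, mem_secAt, forceAt, cond_true, Set.mem_inter_iff] at hω ⊢
  exact ⟨hω.1, fun ω' hω' => hω.2 _ (Set.insert_subset_insert hω')⟩

omit [Fintype ι] in
/-- **Going up, the deep core only grows inside the joint jump set**: `D(U,V)¹ ⊆ D(U,V)⁰ ∪ ((U¹ ∖ U⁰) ∩ (V¹ ∖ V⁰))`. [this work] -/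
theorem secAt_true_deepCore_subset_union (e : ι) (U V : Set (Set ι)) :
    secAt e true (deepCore U V) ⊆ secAt e false (deepCore U V) ∪
      ((secAt e true U \ secAt e false U) ∩ (secAt e true V \ secAt e false V)) := by
  intro ω hω
  by_cases h0 : ω ∈ secAt e false (deepCore U V)
  · exact Or.inl h0
  right
  have hω' : (insert e ω ∈ U ∧ insert e ω ∈ V) ∧ ∀ ω' ⊆ insert e ω, (ω' ∈ U ↔ ω' ∈ V) := by
    simpa only [deepCore, Set.mem_setOf_eq, mem_secAt, forceAt, cond_true, Set.mem_inter_iff] using hω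
  have h0' : ¬ ((ω \ {e} ∈ U ∧ ω \ {e} ∈ V) ∧ ∀ ω' ⊆ ω \ {e}, (ω' ∈ U ↔ ω' ∈ V)) := fun h =>
    h0 (by simpa only [deepCore, Set.mem_setOf_eq, mem_secAt, forceAt, cond_false, Set.mem_inter_iff] using h)
  have hsub : ω \ {e} ⊆ insert e ω := Set.sdiff_subset.trans (Set.subset_insert e ω)
  have hall : ∀ ω' ⊆ ω \ {e}, (ω' ∈ U ↔ ω' ∈ V) := fun ω' h' => hω'.2 ω' (h'.trans hsub)
  have hiff : ω \ {e} ∈ U ↔ ω \ {e} ∈ V := hω'.2 _ hsub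
  have hnot : ¬ (ω \ {e} ∈ U ∧ ω \ {e} ∈ V) := fun h => h0' ⟨h, hall⟩
  simp only [Set.mem_inter_iff, Set.mem_sdiff, mem_secAt, forceAt, cond_true, cond_false]
  exact ⟨⟨hω'.1.1, fun hU => hnot ⟨hU, hiff.1 hU⟩⟩, ⟨hω'.1.2, fun hV => hnot ⟨hiff.2 hV, hV⟩⟩⟩

omit [Fintype ι] in
/-- The deep core of events determined by `S` is determined by `S`. [this work] -/
theorem determinedBy_deepCore {U V : Set (Set ι)} {S : Set ι} (hU : DeterminedBy U S) (hV : DeterminedBy V S) :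
    DeterminedBy (deepCore U V) S := by
  rw [determinedBy_iff] at hU hV ⊢
  intro ω ω' h
  have key : ∀ {ω ω' : Set ι}, ω ∩ S = ω' ∩ S → ω ∈ deepCore U V → ω' ∈ deepCore U V := by
    intro ω ω' h hω
    refine ⟨⟨(hU ω ω' h).1 hω.1.1, (hV ω ω' h).1 hω.1.2⟩, fun η hη => ?_⟩
    -- compare `η ⊆ ω'` with `η' := (η ∩ S) ∪ (ω ∖ S)`... simpler: `η'' := ω ∩ (η ∪ Sᶜ)` has the same trace on `S` as `η`
    have hη' : (ω ∩ (η ∪ Sᶜ)) ∩ S = η ∩ S := by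
      ext i
      simp only [Set.mem_inter_iff, Set.mem_union, Set.mem_compl_iff]
      constructor
      · rintro ⟨⟨-, hi | hi⟩, hiS⟩
        · exact ⟨hi, hiS⟩
        · exact absurd hiS hi
      · rintro ⟨hi, hiS⟩
        have : i ∈ ω' ∩ S := ⟨hη hi, hiS⟩
        rw [← h] at this
        exact ⟨⟨this.1, Or.inl hi⟩, hiS⟩
    have h1 := hω.2 (ω ∩ (η ∪ Sᶜ)) Set.inter_subset_left
    rw [hU _ _ hη', hV _ _ hη'] at h1
    exact h1
  exact ⟨key h, key h.symm⟩

/-! ### 2. Small measure lemmas -/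

/-- Monotonicity of `μ_p` under inclusion. [folklore] -/
private theorem m_le_of_subset (p : ι → unitInterval) {X Y : Set (Set ι)} (h : X ⊆ Y) : m⟦p, X⟧ ≤ m⟦p, Y⟧ :=
  ex_mono (isFKGMeasure_bernoulliWeight p).nonneg fun ω => by
    by_cases hx : ω ∈ X
    · rw [ind_of_mem hx, ind_of_mem (h hx)]
    · rw [ind_of_not_mem hx]; exact ind_nonneg _ _

/-- `0 ≤ μ_p(X)`. [folklore] -/
private theorem m_nonneg (p : ι → unitInterval) (X : Set (Set ι)) : 0 ≤ m⟦p, X⟧ :=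
  ex_nonneg (isFKGMeasure_bernoulliWeight p).nonneg fun ω => ind_nonneg _ ω

/-- Union bound for `μ_p`. [folklore] -/
private theorem m_union_le (p : ι → unitInterval) (X Y : Set (Set ι)) : m⟦p, X ∪ Y⟧ ≤ m⟦p, X⟧ + m⟦p, Y⟧ := by
  have h := SahiCoSunflowerOrCoordinate.ex_ind_union (bernoulliWeight p) X Y
  have h0 := m_nonneg p (X ∩ Y)
  linarith

/-- `μ_p(Y ∖ X) = μ_p(Y) − μ_p(X)` for `X ⊆ Y`. [folklore] -/
private theorem m_diff (p : ι → unitInterval) {X Y : Set (Set ι)} (h : X ⊆ Y) : m⟦p, Y \ X⟧ = m⟦p, Y⟧ - m⟦p, X⟧ :=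
  (Pointwise.ex_ind_sub_of_subset _ h).symm

/-- `μ_p(∅) = 0`. [folklore] -/
private theorem m_empty (p : ι → unitInterval) : m⟦p, (∅ : Set (Set ι))⟧ = 0 := by
  have h0 : ind (∅ : Set (Set ι)) = fun _ => 0 := funext fun ω => ind_of_not_mem (Set.notMem_empty ω)
  rw [h0, ex_def]; simp

/-- `μ_p(univ) = 1`. [folklore] -/
private theorem m_univ (p : ι → unitInterval) : m⟦p, (Set.univ : Set (Set ι))⟧ = 1 := by
  rw [ind_univ_eq_one]; exact ex_one (sum_bernoulliWeight p)

/-- Pointwise bookkeeping behind `μ(U¹∩V¹) − μ(U⁰∩V⁰) + μ(J) ≤ δ_U + δ_V` for nested pairs: with `0/1` values `u₀ ≤ u₁`, `v₀ ≤ v₁`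
the difference is `(u₁ − u₀)(1 − v₁) + (v₁ − v₀)(1 − u₁) ≥ 0`. [this work] -/
private theorem jump_bookkeeping (p : ι → unitInterval) {U₀ U₁ V₀ V₁ : Set (Set ι)} (hU : U₀ ⊆ U₁) (hV : V₀ ⊆ V₁) :
    m⟦p, U₁ ∩ V₁⟧ - m⟦p, U₀ ∩ V₀⟧ + m⟦p, (U₁ \ U₀) ∩ (V₁ \ V₀)⟧ ≤
      (m⟦p, U₁⟧ - m⟦p, U₀⟧) + (m⟦p, V₁⟧ - m⟦p, V₀⟧) := by
  have hpt : ∀ ω, ind (U₁ ∩ V₁) ω + ind ((U₁ \ U₀) ∩ (V₁ \ V₀)) ω + ind U₀ ω + ind V₀ ω ≤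
      ind (U₀ ∩ V₀) ω + ind U₁ ω + ind V₁ ω := by
    intro ω
    by_cases a0 : ω ∈ U₀
    · have a1 : ω ∈ U₁ := hU a0
      have hJ : ω ∉ (U₁ \ U₀) ∩ (V₁ \ V₀) := fun h => h.1.2 a0
      by_cases b0 : ω ∈ V₀
      · have b1 : ω ∈ V₁ := hV b0
        rw [ind_of_mem (show ω ∈ U₁ ∩ V₁ from ⟨a1, b1⟩), ind_of_not_mem hJ, ind_of_mem a0, ind_of_mem b0,
          ind_of_mem (show ω ∈ U₀ ∩ V₀ from ⟨a0, b0⟩), ind_of_mem a1, ind_of_mem b1]; norm_num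
      · rw [ind_of_not_mem hJ, ind_of_mem a0, ind_of_not_mem b0, ind_of_not_mem (show ω ∉ U₀ ∩ V₀ from fun h => b0 h.2),
          ind_of_mem a1]
        by_cases b1 : ω ∈ V₁
        · rw [ind_of_mem (show ω ∈ U₁ ∩ V₁ from ⟨a1, b1⟩), ind_of_mem b1]; norm_num
        · rw [ind_of_not_mem (show ω ∉ U₁ ∩ V₁ from fun h => b1 h.2), ind_of_not_mem b1]; norm_num
    · rw [ind_of_not_mem a0, ind_of_not_mem (show ω ∉ U₀ ∩ V₀ from fun h => a0 h.1)]
      by_cases a1 : ω ∈ U₁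
      · rw [ind_of_mem a1]
        by_cases b0 : ω ∈ V₀
        · have b1 : ω ∈ V₁ := hV b0
          rw [ind_of_mem (show ω ∈ U₁ ∩ V₁ from ⟨a1, b1⟩), ind_of_mem b0, ind_of_mem b1,
            ind_of_not_mem (show ω ∉ (U₁ \ U₀) ∩ (V₁ \ V₀) from fun h => h.2.2 b0)]; norm_num
        · rw [ind_of_not_mem b0]
          by_cases b1 : ω ∈ V₁
          · rw [ind_of_mem (show ω ∈ U₁ ∩ V₁ from ⟨a1, b1⟩), ind_of_mem b1,
              ind_of_mem (show ω ∈ (U₁ \ U₀) ∩ (V₁ \ V₀) from ⟨⟨a1, a0⟩, ⟨b1, b0⟩⟩)]; norm_num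
          · rw [ind_of_not_mem (show ω ∉ U₁ ∩ V₁ from fun h => b1 h.2), ind_of_not_mem b1,
              ind_of_not_mem (show ω ∉ (U₁ \ U₀) ∩ (V₁ \ V₀) from fun h => b1 h.2.1)]; norm_num
      · rw [ind_of_not_mem a1, ind_of_not_mem (show ω ∉ U₁ ∩ V₁ from fun h => a1 h.1),
          ind_of_not_mem (show ω ∉ (U₁ \ U₀) ∩ (V₁ \ V₀) from fun h => a1 h.1.1)]
        by_cases b0 : ω ∈ V₀
        · rw [ind_of_mem b0, ind_of_mem (hV b0)]; norm_num
        · rw [ind_of_not_mem b0]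
          linarith [ind_nonneg V₁ ω]
  have h := ex_mono (isFKGMeasure_bernoulliWeight p).nonneg hpt
  have e1 : ex (bernoulliWeight p) (fun ω => ind (U₁ ∩ V₁) ω + ind ((U₁ \ U₀) ∩ (V₁ \ V₀)) ω + ind U₀ ω + ind V₀ ω) =
      m⟦p, U₁ ∩ V₁⟧ + m⟦p, (U₁ \ U₀) ∩ (V₁ \ V₀)⟧ + m⟦p, U₀⟧ + m⟦p, V₀⟧ := by
    simp only [ex_def, mul_add, sum_add_distrib]
  have e2 : ex (bernoulliWeight p) (fun ω => ind (U₀ ∩ V₀) ω + ind U₁ ω + ind V₁ ω) =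
      m⟦p, U₀ ∩ V₀⟧ + m⟦p, U₁⟧ + m⟦p, V₁⟧ := by
    simp only [ex_def, mul_add, sum_add_distrib]
  rw [e1, e2] at h
  linarith

/-- The real-variable heart of the induction step: `δ_t·(d₁ − d₀) ≤ δ_U·δ_V`. [this work] -/
theorem step_arith {δa δb δt j x : ℝ} (hj : 0 ≤ j) (hja : j ≤ δa) (hjb : j ≤ δb) (hδt : 0 ≤ δt)
    (hδt2 : δt + j ≤ δa + δb) (hx : x ≤ j) : δt * x ≤ δa * δb := by
  by_cases hx0 : x ≤ 0
  · have h1 : δt * x ≤ 0 := mul_nonpos_of_nonneg_of_nonpos hδt hx0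
    nlinarith
  · push Not at hx0
    have h1 : δt * x ≤ δt * j := mul_le_mul_of_nonneg_left hx hδt
    have h2 : δt * j ≤ (δa + δb - j) * j := mul_le_mul_of_nonneg_right (by linarith) hj
    nlinarith [mul_nonneg (sub_nonneg.2 hja) (sub_nonneg.2 hjb)]

/-! ### 3. The deep-core Harris inequality -/

/-- **Deep-core Harris on events determined by a given coordinate set** (induction on the set). [this work] -/
theorem covFun_ge_deepCore_of_determinedBy (S : Finset ι) :
    ∀ (U V : Set (Set ι)), IsUpperSet U → IsUpperSet V → DeterminedBy U (↑S : Set ι) → DeterminedBy V (↑S : Set ι) →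
      ∀ p : ι → unitInterval, m⟦p, deepCore U V⟧ * (1 - m⟦p, U ∩ V⟧) ≤ covFun U V p := by
  induction S using Finset.induction_on with
  | empty =>
    intro U V _ _ hUd hVd p
    simp only [covFun]
    rcases eq_empty_or_univ_of_determinedBy_empty hUd with rfl | rfl
    · have hD : deepCore (∅ : Set (Set ι)) V = ∅ :=
        Set.eq_empty_of_subset_empty fun ω h => (deepCore_subset_inter _ _ h).1
      rw [hD, Set.empty_inter, m_empty]; simp
    · rcases eq_empty_or_univ_of_determinedBy_empty hVd with rfl | rfl
      · have hD : deepCore (Set.univ : Set (Set ι)) ∅ = ∅ :=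
          Set.eq_empty_of_subset_empty fun ω h => (deepCore_subset_inter _ _ h).2
        rw [hD, Set.inter_empty, m_empty]; simp
      · rw [Set.univ_inter, m_univ]; simp
  | insert e S heS ih =>
    intro U V hU hV hUd hVd p
    -- names
    set U0 := secAt e false U with hU0def
    set U1 := secAt e true U with hU1def
    set V0 := secAt e false V with hV0def
    set V1 := secAt e true V with hV1def
    set D := deepCore U V with hDdef
    have hsec : ∀ (b : Bool) (A : Set (Set ι)), IsUpperSet A → DeterminedBy A (↑(insert e S) : Set ι) →
        IsUpperSet (secAt e b A) ∧ DeterminedBy (secAt e b A) (↑S : Set ι) := fun b A hA hAd => by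
      refine ⟨isUpperSet_secAt e b hA, ?_⟩
      have := determinedBy_secAt e b hAd
      rwa [erase_insert heS] at this
    have hU0 := hsec false U hU hUd; have hU1 := hsec true U hU hUd
    have hV0 := hsec false V hV hVd; have hV1 := hsec true V hV hVd
    have hUU : U0 ⊆ U1 := secAt_false_subset_true hU e
    have hVV : V0 ⊆ V1 := secAt_false_subset_true hV e
    -- induction hypotheses at the two sections
    have ih0 := ih U0 V0 hU0.1 hV0.1 hU0.2 hV0.2 p
    have ih1 := ih U1 V1 hU1.1 hV1.1 hU1.2 hV1.2 p
    -- the deep-core sections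
    have hD0 : secAt e false D = deepCore U0 V0 := secAt_false_deepCore e U V
    have hD1 : m⟦p, secAt e true D⟧ ≤ m⟦p, deepCore U1 V1⟧ := m_le_of_subset p (secAt_true_deepCore_subset e U V)
    have hD1' : m⟦p, secAt e true D⟧ ≤ m⟦p, secAt e false D⟧ + m⟦p, (U1 \ U0) ∩ (V1 \ V0)⟧ :=
      (m_le_of_subset p (secAt_true_deepCore_subset_union e U V)).trans (m_union_le p _ _)
    -- scalar facts
    have hja : m⟦p, (U1 \ U0) ∩ (V1 \ V0)⟧ ≤ m⟦p, U1⟧ - m⟦p, U0⟧ := by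
      rw [← m_diff p hUU]; exact m_le_of_subset p Set.inter_subset_left
    have hjb : m⟦p, (U1 \ U0) ∩ (V1 \ V0)⟧ ≤ m⟦p, V1⟧ - m⟦p, V0⟧ := by
      rw [← m_diff p hVV]; exact m_le_of_subset p Set.inter_subset_right
    have hj0 := m_nonneg p ((U1 \ U0) ∩ (V1 \ V0))
    have ht01 : m⟦p, U0 ∩ V0⟧ ≤ m⟦p, U1 ∩ V1⟧ := m_le_of_subset p (Set.inter_subset_inter hUU hVV)
    have ht1 : m⟦p, U1 ∩ V1⟧ ≤ 1 := ex_bernoulliWeight_ind_le_one p _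
    have hbook := jump_bookkeeping p hUU hVV
    have hd0 := m_nonneg p (secAt e false D)
    have hpe0 : 0 ≤ (p e : ℝ) := (p e).2.1
    have hpe1 : (p e : ℝ) ≤ 1 := (p e).2.2
    -- IH in usable form
    have ih1' : m⟦p, secAt e true D⟧ * (1 - m⟦p, U1 ∩ V1⟧) ≤ covFun U1 V1 p :=
      le_trans (mul_le_mul_of_nonneg_right hD1 (sub_nonneg.2 ht1)) ih1
    rw [hD0] at hd0 hD1'
    -- the key product inequality
    have hkey : (m⟦p, U1 ∩ V1⟧ - m⟦p, U0 ∩ V0⟧) * (m⟦p, secAt e true D⟧ - m⟦p, deepCore U0 V0⟧) ≤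
        (m⟦p, U1⟧ - m⟦p, U0⟧) * (m⟦p, V1⟧ - m⟦p, V0⟧) :=
      step_arith hj0 hja hjb (sub_nonneg.2 ht01) (by linarith) (by linarith)
    -- decompose the three `n`-dimensional quantities along `e`
    have hDm : m⟦p, D⟧ = (p e : ℝ) * m⟦p, secAt e true D⟧ + (1 - (p e : ℝ)) * m⟦p, deepCore U0 V0⟧ := by
      rw [← hD0]; exact ex_ind_eq_secAt p e D
    have hTm : m⟦p, U ∩ V⟧ = (p e : ℝ) * m⟦p, U1 ∩ V1⟧ + (1 - (p e : ℝ)) * m⟦p, U0 ∩ V0⟧ := by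
      rw [ex_ind_eq_secAt p e (U ∩ V), secAt_inter, secAt_inter]
    rw [hDm, hTm, covFun_eq_secAt U V e p]
    nlinarith [mul_nonneg hpe0 (sub_nonneg.2 hpe1), ih0, ih1', hkey,
      mul_nonneg (mul_nonneg hpe0 (sub_nonneg.2 hpe1)) (sub_nonneg.2 hkey),
      mul_nonneg hpe0 (sub_nonneg.2 (sub_nonneg.2 hpe1)),
      mul_nonneg (sub_nonneg.2 hpe1) (sub_nonneg.2 ih0), mul_nonneg hpe0 (sub_nonneg.2 ih1')]

/-- **THEOREM (deep-core Harris inequality).**  For every finite cube, product weight `p` and increasing events `U, V`: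
`μ(D(U,V))·(1 − μ(U ∩ V)) ≤ Cov(U,V) = μ(U ∩ V) − μ(U)μ(V)`, `D(U,V)` the deep core. [this work] -/
theorem covFun_ge_deepCore (p : ι → unitInterval) {U V : Set (Set ι)} (hU : IsUpperSet U) (hV : IsUpperSet V) :
    m⟦p, deepCore U V⟧ * (1 - m⟦p, U ∩ V⟧) ≤ covFun U V p :=
  covFun_ge_deepCore_of_determinedBy Finset.univ U V hU hV
    (determinedBy_coe_univ U) (determinedBy_coe_univ V) p

/-- **Deep-core Harris, unfolded**: `μ(U ∩ V) − μ(U)·μ(V) ≥ μ(D(U,V))·(1 − μ(U ∩ V))`. [this work] -/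
theorem deepCore_harris (p : ι → unitInterval) {U V : Set (Set ι)} (hU : IsUpperSet U) (hV : IsUpperSet V) :
    m⟦p, deepCore U V⟧ * (1 - m⟦p, U ∩ V⟧) ≤ m⟦p, U ∩ V⟧ - m⟦p, U⟧ * m⟦p, V⟧ :=
  covFun_ge_deepCore p hU hV

/-- **Deep-core Harris for the product measure `prodBernoulli`** (the `Literature` vocabulary). [this work] -/
theorem deepCore_harris_prodBernoulli (p : ι → unitInterval) {U V : Set (Set ι)} (hU : IsUpperSet U) (hV : IsUpperSet V) :
    (prodBernoulli p).real (deepCore U V) * (1 - (prodBernoulli p).real (U ∩ V)) ≤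
      (prodBernoulli p).real (U ∩ V) - (prodBernoulli p).real U * (prodBernoulli p).real V := by
  have h := deepCore_harris p hU hV
  simpa only [ex_bernoulliWeight_ind] using h

/-- **Corollary (defect outside an increasing event).**  If `N` is increasing and contains `U ∖ V` and `V ∖ U`, then
`μ((U ∩ V) ∖ N)·(1 − μ(U ∩ V)) ≤ Cov(U,V)` — the form used by the class-law reduction (`N` = the third member). [this work] -/
theorem inter_diff_harris (p : ι → unitInterval) {U V N : Set (Set ι)} (hU : IsUpperSet U) (hV : IsUpperSet V)
    (hN : IsUpperSet N) (hUV : U \ V ⊆ N) (hVU : V \ U ⊆ N) :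
    m⟦p, (U ∩ V) \ N⟧ * (1 - m⟦p, U ∩ V⟧) ≤ m⟦p, U ∩ V⟧ - m⟦p, U⟧ * m⟦p, V⟧ :=
  le_trans (mul_le_mul_of_nonneg_right (m_le_of_subset p (inter_diff_subset_deepCore hN hUV hVU))
    (sub_nonneg.2 (ex_bernoulliWeight_ind_le_one p _))) (deepCore_harris p hU hV)


end SahiDeepCore

end Summit.CriticalPhenomena.PercolationContinuityZ3.Theorems
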